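import Summits.CriticalPhenomena.PercolationContinuityZ3.Theorems.PercNearOneGluingNoHeavyLowerTailKnDesignationTwoRelays
import HarnessLib

/-!
# Mixed designations for two relays: `ε·μ(·↔b, o↔A) + μ(·↔b ∩ D)`, `ε ≥ 0` — Kozma–Nitzan's Theorem 1 (Question 7 at
# `|A| = 2`) as the member `ε = 1`, `D = {o ↮ A}` of the pocket-designation family

Helper for crux `PercNearOneGluingNoHeavy.NoHeavyLowerTail` (item stmt-CriticalPhenomena-4575, closed), lemma factory
prim-lf-2 (deletion–contraction), gen 14.  No definitions, no named facts, no sorries; standard axioms.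

`KnQ8.block41_pair_of_downEvent` (this seat, p211396) proves the pre-FKG inequality (41) at `o` for the relay `c` of
`A = {a, c}` minimising `μ({·↔b} ∩ D)`, `D = {C_o ∈ 𝒟}` any decreasing pocket event.  This file adds the observation
(seat memo Q8Q9-LANDSCAPE-gen14.md §3.2) that the family is closed under adding a nonnegative multiple of
`L(·) := μ({·↔b} ∩ {o↔A})` to the score: if `c` minimises `ε·L + μ({·↔b} ∩ D)` with `ε ≥ 0` then either `c` minimises the
`D`-score (and the theorem applies to `c`), or `a` does, the theorem gives `L(a) ≤ R := μ({o↔b} ∩ {o↔A})`, and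
`ε·(L(c) − L(a)) ≤ μ({a↔b}∩D) − μ({c↔b}∩D) < 0` forces `L(c) < L(a) ≤ R` — which IS (41) for `c`, since (41) for `x` reads
`L(x) ≤ R`.  With `D = {o↮A}` and `ε = 1` the score is `μ(·↔b, o↔A) + μ(·↔b, o↮A) = μ(·↔b)`: the designated form of
Kozma–Nitzan's Theorem 1 (Question 7 for two relays) is the member `(1, {o↮A})`, Question 8 is `(0, {o↮A})`, Question 9
is `(0, {o isolated})`.

* `KnQ8.block41_pair_of_mixed_downEvent` — the mixed designation, both relays missed by the pockets of `𝒟`, positive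
  masses `μ({c↮a}∩{c↮o}∩D)`, `μ({a↮c}∩{a↮o}∩D)`;
* `KnQ8.block41_pair_of_mixed_avoid_lt_one` — the `T`-family form (`D = {o↮T}`, `A ⊆ T ∌ o`) without weight-`1` pairs;
* `KnQ8.knTheorem1_designated_pair` — `μ(c↔b) ≤ μ(a↔b) ⟹ μ({c↔b}∩{o↔A}) ≤ μ({o↔b}∩{o↔A})`, `A = {a,c}`, on every finite
  graph without weight-`1` pairs, as the member `ε = 1`, `T = A` (the tree has Theorem 1 in `min` form,
  `KNPreFKG.preFKG_pair`, and Question 7 for every `|A|` via the conditioned slack hierarchy, `Q7Psi.kn_question7`; this is a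
  third, elementary route for `|A| = 2`).
[cite: KozmaNitzan2024, Theorem 1 (pp. 7–8), Questions 7–9 (§5.5 p. 36)] [cite: VandenbergHaggstromKahn2005, Thms. 1.3–1.5 (pp. 6–8)]
-/

noncomputable section

namespace Summit.CriticalPhenomena.PercolationContinuityZ3.Theorems

open MeasureTheory Set
open Literature.Probability.LatticeModels (prodBernoulli)
open Literature.Probability.Percolation
open scoped Classical

namespace KnQ8

variable {V : Type*} [Fintype V]

/-- **Mixed designation for two relays.**  `A = {a, c}`, `a ≠ c`, `o ∉ A`; `𝒟` down-closed with `a, c ∉ S` for all `S ∈ 𝒟`,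
`D = {C_o ∈ 𝒟}`, `U = {o↔a} ∪ {o↔c}`, `ε ≥ 0`.  If `ε·μ({c↔b}∩U) + μ({c↔b}∩D) ≤ ε·μ({a↔b}∩U) + μ({a↔b}∩D)` and the two
masses `μ({c↮a}∩{c↮o}∩D)`, `μ({a↮c}∩{a↮o}∩D)` are positive, then `μ({c↔b} ∩ U) ≤ μ({o↔b} ∩ U)`.
[cite: KozmaNitzan2024, Questions 7–9 (§5.5 p. 36), Theorem 1 (pp. 7–8)] -/
theorem block41_pair_of_mixed_downEvent (w : Sym2 V → unitInterval) (o b a c : V) (hac : a ≠ c) (hoc : o ≠ c)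
    (hoa : o ≠ a) (𝒟 : Set (Set V)) (h𝒟 : ∀ S S' : Set V, S ⊆ S' → S' ∈ 𝒟 → S ∈ 𝒟) (hc𝒟 : ∀ S ∈ 𝒟, c ∉ S)
    (ha𝒟 : ∀ S ∈ 𝒟, a ∉ S) (ε : ℝ) (hε : 0 ≤ ε)
    (hmin : ε * (prodBernoulli w).real (openConn c b ∩ (openConn o a ∪ openConn o c)) +
        (prodBernoulli w).real (openConn c b ∩ {ω | openCluster ω o ∈ 𝒟}) ≤
      ε * (prodBernoulli w).real (openConn a b ∩ (openConn o a ∪ openConn o c)) +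
        (prodBernoulli w).real (openConn a b ∩ {ω | openCluster ω o ∈ 𝒟}))
    (hposc : 0 < (prodBernoulli w).real
      ({ω : BondConfig V | ¬ (openGraph ω).Reachable c a} ∩ {ω | ¬ (openGraph ω).Reachable c o} ∩
        {ω | openCluster ω o ∈ 𝒟}))
    (hposa : 0 < (prodBernoulli w).real
      ({ω : BondConfig V | ¬ (openGraph ω).Reachable a c} ∩ {ω | ¬ (openGraph ω).Reachable a o} ∩
        {ω | openCluster ω o ∈ 𝒟})) :
    (prodBernoulli w).real (openConn c b ∩ (openConn o a ∪ openConn o c)) ≤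
      (prodBernoulli w).real (openConn o b ∩ (openConn o a ∪ openConn o c)) := by
  set μ := prodBernoulli w with hμ
  set U : Set (BondConfig V) := openConn o a ∪ openConn o c with hU
  set D : Set (BondConfig V) := {ω | openCluster ω o ∈ 𝒟} with hD
  by_cases hcase : μ.real (openConn c b ∩ D) ≤ μ.real (openConn a b ∩ D)
  · exact block41_pair_of_downEvent w o b a c hac hoc 𝒟 h𝒟 hc𝒟 hcase hposc
  · -- `a` is the strict `D`-minimiser: (41) for `a`, and `ε (L c − L a) < 0`
    have hlt : μ.real (openConn a b ∩ D) < μ.real (openConn c b ∩ D) := lt_of_not_ge hcase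
    have h41a := block41_pair_of_downEvent w o b c a (Ne.symm hac) hoa 𝒟 h𝒟 ha𝒟 hlt.le hposa
    -- `h41a : μ(ab ∩ (oc ∪ oa)) ≤ μ(ob ∩ (oc ∪ oa))`
    rw [union_comm (openConn o c) (openConn o a)] at h41a
    have hεpos : 0 < ε := by
      by_contra h
      have hε0 : ε = 0 := le_antisymm (not_lt.1 h) hε
      rw [hε0, zero_mul, zero_mul, zero_add, zero_add] at hmin
      exact hcase hmin
    have hL : ε * μ.real (openConn c b ∩ U) < ε * μ.real (openConn a b ∩ U) := by linarith
    have hL' : μ.real (openConn c b ∩ U) < μ.real (openConn a b ∩ U) := lt_of_mul_lt_mul_left hL hε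
    exact (hL'.le).trans h41a

/-- **Mixed designation, `T`-family, no weight-`1` pairs.**  `A = {a,c} ⊆ T`, `o ∉ T`, `ε ≥ 0`: if `c` minimises
`ε·μ({·↔b} ∩ {o↔A}) + μ({·↔b} ∩ {o↮T})` over `A` then (41) holds at `o` for `c`.
[cite: KozmaNitzan2024, Questions 7–9 (§5.5 p. 36)] -/
theorem block41_pair_of_mixed_avoid_lt_one (w : Sym2 V → unitInterval) (hw : ∀ e, w e < 1) (o b a c : V)
    (hac : a ≠ c) (hoc : o ≠ c) (hoa : o ≠ a) (T : Set V) (hcT : c ∈ T) (haT : a ∈ T) (hoT : o ∉ T) (ε : ℝ) (hε : 0 ≤ ε)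
    (hmin : ε * (prodBernoulli w).real (openConn c b ∩ (openConn o a ∪ openConn o c)) +
        (prodBernoulli w).real (openConn c b ∩ {ω | ∀ t ∈ T, ¬ (openGraph ω).Reachable o t}) ≤
      ε * (prodBernoulli w).real (openConn a b ∩ (openConn o a ∪ openConn o c)) +
        (prodBernoulli w).real (openConn a b ∩ {ω | ∀ t ∈ T, ¬ (openGraph ω).Reachable o t})) :
    (prodBernoulli w).real (openConn c b ∩ (openConn o a ∪ openConn o c)) ≤
      (prodBernoulli w).real (openConn o b ∩ (openConn o a ∪ openConn o c)) := by
  set 𝒟 : Set (Set V) := {S | ∀ t ∈ T, t ∉ S} with h𝒟def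
  have eD : {ω : BondConfig V | openCluster ω o ∈ 𝒟} = {ω | ∀ t ∈ T, ¬ (openGraph ω).Reachable o t} := by
    ext ω; simp only [mem_setOf_eq, h𝒟def, openCluster]
  have h𝒟 : ∀ S S' : Set V, S ⊆ S' → S' ∈ 𝒟 → S ∈ 𝒟 := fun S S' hSS' hS' t ht hts => hS' t ht (hSS' hts)
  have hc𝒟 : ∀ S ∈ 𝒟, c ∉ S := fun S hS hcS => hS c hcT hcS
  have ha𝒟 : ∀ S ∈ 𝒟, a ∉ S := fun S hS haS => hS a haT haS
  refine block41_pair_of_mixed_downEvent w o b a c hac hoc hoa 𝒟 h𝒟 hc𝒟 ha𝒟 ε hε ?_ ?_ ?_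
  · rw [eD]; exact hmin
  · rw [eD]
    refine real_pos_of_empty_mem w hw ?_
    simp only [mem_inter_iff, mem_setOf_eq, reachable_empty_iff]
    exact ⟨⟨fun h => hac h.symm, fun h => hoc h.symm⟩, fun t ht h => hoT (h ▸ ht)⟩
  · rw [eD]
    refine real_pos_of_empty_mem w hw ?_
    simp only [mem_inter_iff, mem_setOf_eq, reachable_empty_iff]
    exact ⟨⟨hac, fun h => hoa h.symm⟩, fun t ht h => hoT (h ▸ ht)⟩

/-- **Kozma–Nitzan's Theorem 1 in designated form (Question 7 for two relays), as the member `ε = 1`, `T = A` of the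
family**: on every finite graph without weight-`1` pairs, for `A = {a, c}`, `o ∉ A`, `a ≠ c`:
`μ(c↔b) ≤ μ(a↔b) ⟹ μ({c↔b} ∩ {o↔A}) ≤ μ({o↔b} ∩ {o↔A})`  (`μ(x↔b) = μ({x↔b}∩{o↔A}) + μ({x↔b}∩{o↮A})`).
[cite: KozmaNitzan2024, Theorem 1 (pp. 7–8), Question 7 (§5.5 p. 36)] -/
theorem knTheorem1_designated_pair (w : Sym2 V → unitInterval) (hw : ∀ e, w e < 1) (o b a c : V) (hac : a ≠ c)
    (hoc : o ≠ c) (hoa : o ≠ a)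
    (hmin : (prodBernoulli w).real (openConn c b) ≤ (prodBernoulli w).real (openConn a b)) :
    (prodBernoulli w).real (openConn c b ∩ (openConn o a ∪ openConn o c)) ≤
      (prodBernoulli w).real (openConn o b ∩ (openConn o a ∪ openConn o c)) := by
  set μ := prodBernoulli w with hμ
  set U : Set (BondConfig V) := openConn o a ∪ openConn o c with hU
  have eT : {ω : BondConfig V | ∀ t ∈ ({a, c} : Set V), ¬ (openGraph ω).Reachable o t} = Uᶜ := by
    ext ω
    simp only [mem_setOf_eq, mem_insert_iff, mem_singleton_iff, forall_eq_or_imp, forall_eq, hU, mem_compl_iff,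
      mem_union, openConn, not_or]
  have hUm : MeasurableSet U := MeasurableSet.of_discrete
  have hsplit : ∀ x : V, μ.real (openConn x b) = μ.real (openConn x b ∩ U) + μ.real (openConn x b ∩ Uᶜ) := by
    intro x
    rw [← measureReal_inter_add_sdiff (s := openConn x b) hUm, Set.sdiff_eq]
  refine block41_pair_of_mixed_avoid_lt_one w hw o b a c hac hoc hoa {a, c} (by simp) (by simp)
    (by simp only [mem_insert_iff, mem_singleton_iff, not_or]; exact ⟨hoa, hoc⟩) 1 zero_le_one ?_
  rw [eT, one_mul, one_mul, ← hsplit c, ← hsplit a]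
  exact hmin

end KnQ8

end Summit.CriticalPhenomena.PercolationContinuityZ3.Theorems

end
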